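import Mathlib
import HarnessLib
import Literature.Probability.Divergences.FDivVariational

/-!
# Ledger assembly for the crux `KineticCurrentsWindowLDUniform` (stmt-AtomisticToContinuum-14662),
# line `gossip-forecast-ledger`, stub `stub_ledgerAssembly` (S5) — helper file A: tilted-measure duality

Helper file A (pure measure theory, no dynamics) of the registered stub `stub_ledgerAssembly` of the
line skeleton `Cruxes/KineticCurrentsWindowLDUniform/Lines/gossip_forecast_ledger.lean`; files B
`…LedgerAssemblyStatics` (static exponential moments), C `…LedgerAssemblyCore` (the ledger at one sign
of `β`) and D `…LedgerAssembly` (the registered statement).  Contents: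

* `integrable_exp_of_lintegral_le` — `∫⁻ e^g ≤ e^B` gives `e^g ∈ L¹` and `∫ e^g ≤ e^B`;
* `integral_le_klDiv_add_log`, `integral_le_of_exp_moment` — the (easy half of the) Donsker–Varadhan
  entropy inequality `∫ Y dQ ≤ KL(Q‖P) + log ∫ e^Y dP` for probability measures, from the tree's
  variational bound `Literature.Probability.Divergences.integral_le_toReal_klDiv_add_integral`;
* `integrable_tilted_of_exp_moments` — `Y ∈ L¹(P.tilted g)` from `e^g, e^{2g}, e^{2c|Y|} ∈ L¹(P)`;
* `klDiv_tilted_eq` — the Gibbs variational identity `KL(P.tilted g ‖ P) = ∫ g d(P.tilted g) − log ∫ e^g dP`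
  for exponentially integrable `g` (Mathlib `log_rnDeriv_tilted_left_self`; the tree's
  `KineticEntropyCollisionBudget.tilted_klDiv_toReal_eq` is the bounded case);
* `integrable_exp_mul_condExp` — conditional Jensen for `e^{cx}` (`ConvexOn.map_condExp_le_univ`).

Reference: C. Kipnis, C. Landim, *Scaling Limits of Interacting Particle Systems* (1999), App. 1 §8.
-/

noncomputable section

open MeasureTheory Set Filter InformationTheory
open scoped ENNReal Topology Classical ProbabilityTheory

namespace Summit.AtomisticToContinuum.HydrodynamicLimit.Theorems.KineticCurrentsWindowLDUniformGossip

namespace LedgerAssembly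

/-! ### Generic probabilistic steps -/

section Generic

variable {Ω : Type*} [MeasurableSpace Ω]

/-- From a lower-integral exponential bound `∫⁻ e^g ≤ e^B`: `e^g` is integrable and `∫ e^g ≤ e^B`. [folklore] -/
theorem integrable_exp_of_lintegral_le {μ : Measure Ω} {g : Ω → ℝ} (hg : AEStronglyMeasurable g μ)
    {B : ℝ} (h : ∫⁻ ω, ENNReal.ofReal (Real.exp (g ω)) ∂μ ≤ ENNReal.ofReal (Real.exp B)) :
    Integrable (fun ω => Real.exp (g ω)) μ ∧ ∫ ω, Real.exp (g ω) ∂μ ≤ Real.exp B := by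
  have hm : AEStronglyMeasurable (fun ω => Real.exp (g ω)) μ :=
    Real.continuous_exp.comp_aestronglyMeasurable hg
  have hne : ∫⁻ ω, ENNReal.ofReal (Real.exp (g ω)) ∂μ ≠ ∞ :=
    ne_top_of_le_ne_top ENNReal.ofReal_ne_top h
  have hint : Integrable (fun ω => Real.exp (g ω)) μ :=
    (lintegral_ofReal_ne_top_iff_integrable hm (ae_of_all _ fun _ => (Real.exp_pos _).le)).1 hne
  refine ⟨hint, ?_⟩
  rw [integral_eq_lintegral_of_nonneg_ae (ae_of_all _ fun _ => (Real.exp_pos _).le) hm]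
  exact (ENNReal.toReal_mono ENNReal.ofReal_ne_top h).trans_eq
    (ENNReal.toReal_ofReal (Real.exp_pos B).le)

/-- **Donsker–Varadhan entropy inequality** (easy half): for probability measures `Q ≪ P` with
`KL(Q‖P) < ∞`, `Y ∈ L¹(Q)` and `e^Y ∈ L¹(P)`, `∫ Y dQ ≤ KL(Q‖P) + log ∫ e^Y dP`. [folklore] -/
theorem integral_le_klDiv_add_log {P Q : Measure Ω} [IsProbabilityMeasure P] [IsProbabilityMeasure Q]
    (hfin : klDiv Q P ≠ ∞) {Y : Ω → ℝ} (hYQ : Integrable Y Q)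
    (hexp : Integrable (fun ω => Real.exp (Y ω)) P) :
    ∫ ω, Y ω ∂Q ≤ (klDiv Q P).toReal + Real.log (∫ ω, Real.exp (Y ω) ∂P) := by
  set Z := ∫ ω, Real.exp (Y ω) ∂P with hZ
  have hZpos : 0 < Z := integral_exp_pos hexp
  have hg : Integrable (fun ω => Y ω - Real.log Z) Q := hYQ.sub (integrable_const _)
  have hexp' : Integrable (fun ω => Real.exp (Y ω - Real.log Z)) P := by
    simp_rw [Real.exp_sub, Real.exp_log hZpos]
    exact hexp.div_const Z
  have h := Literature.Probability.Divergences.integral_le_toReal_klDiv_add_integral hfin hg hexp'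
  have h1 : ∫ ω, (Y ω - Real.log Z) ∂Q = ∫ ω, Y ω ∂Q - Real.log Z := by
    rw [integral_sub hYQ (integrable_const _), integral_const, probReal_univ, one_smul]
  have h2 : ∫ ω, (Real.exp (Y ω - Real.log Z) - 1) ∂P = 0 := by
    simp_rw [Real.exp_sub, Real.exp_log hZpos]
    rw [integral_sub (hexp.div_const Z) (integrable_const _), integral_div, ← hZ,
      div_self hZpos.ne', integral_const, probReal_univ, one_smul, sub_self]
  rw [h1, h2, add_zero] at h
  linarith

/-- Scaled Donsker–Varadhan: `∫ Y dQ ≤ (KL(Q‖P) + B)/c` when `∫ e^{cY} dP ≤ e^B`, `c > 0`. [folklore] -/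
theorem integral_le_of_exp_moment {P Q : Measure Ω} [IsProbabilityMeasure P] [IsProbabilityMeasure Q]
    (hfin : klDiv Q P ≠ ∞) {Y : Ω → ℝ} (hYQ : Integrable Y Q) {c B : ℝ} (hc : 0 < c)
    (hexp : Integrable (fun ω => Real.exp (c * Y ω)) P)
    (hB : ∫ ω, Real.exp (c * Y ω) ∂P ≤ Real.exp B) :
    ∫ ω, Y ω ∂Q ≤ ((klDiv Q P).toReal + B) / c := by
  have h := integral_le_klDiv_add_log hfin (hYQ.const_mul c) hexp
  rw [integral_const_mul] at h
  have hlog : Real.log (∫ ω, Real.exp (c * Y ω) ∂P) ≤ B := by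
    rw [← Real.log_exp B]
    exact Real.log_le_log (integral_exp_pos hexp) hB
  rw [le_div_iff₀ hc]
  linarith

/-- Integrability under a tilt from exponential moments: if `e^g, e^{2g} ∈ L¹(P)` and
`e^{2c|Y|} ∈ L¹(P)` for some `c > 0`, then `Y ∈ L¹(P.tilted g)`. [folklore] -/
theorem integrable_tilted_of_exp_moments {P : Measure Ω} [IsFiniteMeasure P] {g Y : Ω → ℝ}
    (hg : Integrable (fun ω => Real.exp (g ω)) P)
    (h2g : Integrable (fun ω => Real.exp (2 * g ω)) P)
    (hY : AEStronglyMeasurable Y P) {c : ℝ} (hc : 0 < c)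
    (hYc : Integrable (fun ω => Real.exp (2 * c * |Y ω|)) P) :
    Integrable Y (P.tilted g) := by
  rw [integrable_tilted_iff hg]
  refine Integrable.mono' ((h2g.add hYc).div_const (2 * c)) (hg.1.smul hY) (ae_of_all _ fun ω => ?_)
  rw [norm_smul, Real.norm_eq_abs, Real.norm_eq_abs, abs_of_pos (Real.exp_pos _)]
  have h1 : c * |Y ω| ≤ Real.exp (c * |Y ω|) := by linarith [Real.add_one_le_exp (c * |Y ω|)]
  have ha : Real.exp (g ω) ^ 2 = Real.exp (2 * g ω) := by
    rw [sq, ← Real.exp_add]; ring_nf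
  have hb : Real.exp (c * |Y ω|) ^ 2 = Real.exp (2 * c * |Y ω|) := by
    rw [sq, ← Real.exp_add]; ring_nf
  have h2 : 2 * Real.exp (g ω) * Real.exp (c * |Y ω|) ≤
      Real.exp (2 * g ω) + Real.exp (2 * c * |Y ω|) := by
    rw [← ha, ← hb]
    exact two_mul_le_add_sq _ _
  rw [le_div_iff₀ (by positivity)]
  calc Real.exp (g ω) * |Y ω| * (2 * c) = 2 * Real.exp (g ω) * (c * |Y ω|) := by ring
    _ ≤ 2 * Real.exp (g ω) * Real.exp (c * |Y ω|) :=
        mul_le_mul_of_nonneg_left h1 (by positivity)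
    _ ≤ _ := h2

/-- **Gibbs variational principle at the tilt.** For a probability measure `P`, `e^g ∈ L¹(P)` and
`g ∈ L¹(P.tilted g)`: `KL(P.tilted g ‖ P) < ∞` and `KL = ∫ g d(P.tilted g) − log ∫ e^g dP`. [folklore] -/
theorem klDiv_tilted_eq {P : Measure Ω} [IsProbabilityMeasure P] {g : Ω → ℝ}
    (hg : Integrable (fun ω => Real.exp (g ω)) P) (hgQ : Integrable g (P.tilted g)) :
    klDiv (P.tilted g) P ≠ ∞ ∧
      (klDiv (P.tilted g) P).toReal =
        ∫ ω, g ω ∂(P.tilted g) - Real.log (∫ ω, Real.exp (g ω) ∂P) := by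
  -- adapted from `KineticEntropyCollisionBudget.tilted_klDiv_toReal_eq` (bounded case)
  haveI : IsProbabilityMeasure (P.tilted g) := isProbabilityMeasure_tilted hg
  have hac : P.tilted g ≪ P := tilted_absolutelyContinuous P g
  have hllr : llr (P.tilted g) P =ᵐ[P.tilted g]
      fun ω => g ω - Real.log (∫ ω, Real.exp (g ω) ∂P) :=
    hac.ae_le (log_rnDeriv_tilted_left_self hg)
  have hsub : Integrable (fun ω => g ω - Real.log (∫ ω, Real.exp (g ω) ∂P)) (P.tilted g) :=
    hgQ.sub (integrable_const _)
  have hint : Integrable (llr (P.tilted g) P) (P.tilted g) := (integrable_congr hllr).2 hsub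
  refine ⟨klDiv_ne_top hac hint, ?_⟩
  rw [toReal_klDiv_of_measure_eq hac (by simp), integral_congr_ae hllr,
    integral_sub hgQ (integrable_const _), integral_const, probReal_univ, one_smul]

/-- Convexity of `x ↦ e^{c x}`. [folklore] -/
theorem convexOn_exp_const_mul (c : ℝ) : ConvexOn ℝ univ (fun x : ℝ => Real.exp (c * x)) := by
  refine ⟨convex_univ, fun x _ y _ p q hp hq hpq => ?_⟩
  have h := convexOn_exp.2 (mem_univ (c * x)) (mem_univ (c * y)) hp hq hpq
  simp only [smul_eq_mul] at h ⊢
  calc Real.exp (c * (p * x + q * y)) = Real.exp (p * (c * x) + q * (c * y)) := by ring_nf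
    _ ≤ p * Real.exp (c * x) + q * Real.exp (c * y) := h

/-- Measurability of a series of measurable real functions. [folklore] -/
theorem aestronglyMeasurable_tsum {μ : Measure Ω} {V : ℕ → Ω → ℝ} (hVm : ∀ k, Measurable (V k)) :
    AEStronglyMeasurable (fun ω => ∑' k, V k ω) μ :=
  (StronglyMeasurable.tsum fun k => (hVm k).stronglyMeasurable).aestronglyMeasurable

end Generic

section CondJensen

variable {Ω : Type*} {m mΩ : MeasurableSpace Ω} {P : Measure Ω} [IsFiniteMeasure P]

/-- Conditional Jensen for `e^{c x}`: `e^{c P[X|m]}` is integrable and `∫ e^{c P[X|m]} ≤ ∫ e^{cX}`. [folklore] -/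
theorem integrable_exp_mul_condExp (hm : m ≤ mΩ) {X : Ω → ℝ} (hX : Integrable X P) (c : ℝ)
    (hexp : Integrable (fun ω => Real.exp (c * X ω)) P) :
    Integrable (fun ω => Real.exp (c * (P[X|m]) ω)) P ∧
      ∫ ω, Real.exp (c * (P[X|m]) ω) ∂P ≤ ∫ ω, Real.exp (c * X ω) ∂P := by
  have hconv := convexOn_exp_const_mul c
  have hcont : LowerSemicontinuous (fun x : ℝ => Real.exp (c * x)) :=
    (Real.continuous_exp.comp (continuous_const.mul continuous_id)).lowerSemicontinuous
  have hJ := hconv.map_condExp_le_univ (μ := P) (f := X) hm hcont hX hexp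
  have hsm : StronglyMeasurable[mΩ] (P[X|m]) := stronglyMeasurable_condExp.mono hm
  have hmeas : AEStronglyMeasurable (fun ω => Real.exp (c * (P[X|m]) ω)) P :=
    (Real.continuous_exp.comp_stronglyMeasurable (hsm.const_mul c)).aestronglyMeasurable
  have hle : ∀ᵐ ω ∂P, Real.exp (c * (P[X|m]) ω) ≤ (P[(fun x : ℝ => Real.exp (c * x)) ∘ X|m]) ω := by
    filter_upwards [hJ] with ω hω
    simpa only [Function.comp_apply] using hω
  have hint : Integrable (fun ω => Real.exp (c * (P[X|m]) ω)) P := by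
    refine (integrable_condExp (μ := P) (m := m) (f := (fun x : ℝ => Real.exp (c * x)) ∘ X)).mono' hmeas ?_
    filter_upwards [hle] with ω hω
    rw [Real.norm_eq_abs, abs_of_pos (Real.exp_pos _)]
    exact hω
  refine ⟨hint, ?_⟩
  calc ∫ ω, Real.exp (c * (P[X|m]) ω) ∂P
      ≤ ∫ ω, (P[(fun x : ℝ => Real.exp (c * x)) ∘ X|m]) ω ∂P :=
        integral_mono_ae hint integrable_condExp hle
    _ = ∫ ω, ((fun x : ℝ => Real.exp (c * x)) ∘ X) ω ∂P := integral_condExp hm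
    _ = ∫ ω, Real.exp (c * X ω) ∂P := rfl

end CondJensen

end LedgerAssembly

/-- **Registered helper stub `stub_ledgerAssembly_duality`** (helper file A of S5, line
`gossip-forecast-ledger`, crux stmt-AtomisticToContinuum-14662): the scaled Donsker–Varadhan entropy
inequality — for probability measures `Q`, `P` with `KL(Q‖P) < ∞`, `Y ∈ L¹(Q)`, `c > 0` and
`∫ e^{cY} dP ≤ e^B`: `∫ Y dQ ≤ (KL(Q‖P) + B)/c`. [folklore] -/
theorem stub_ledgerAssembly_duality :
    ∀ (Ω : Type) [MeasurableSpace Ω] (P Q : Measure Ω) [IsProbabilityMeasure P] [IsProbabilityMeasure Q],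
      klDiv Q P ≠ ∞ → ∀ (Y : Ω → ℝ), Integrable Y Q → ∀ (c B : ℝ), 0 < c →
      Integrable (fun ω => Real.exp (c * Y ω)) P → ∫ ω, Real.exp (c * Y ω) ∂P ≤ Real.exp B →
      ∫ ω, Y ω ∂Q ≤ ((klDiv Q P).toReal + B) / c :=
  fun _Ω _ _P _Q _ _ hfin _Y hYQ _c _B hc hexp hB =>
    LedgerAssembly.integral_le_of_exp_moment hfin hYQ hc hexp hB

end Summit.AtomisticToContinuum.HydrodynamicLimit.Theorems.KineticCurrentsWindowLDUniformGossip

end
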